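import Mathlib

/-!
# `ChargedEnergyGap` · the CHART DIAL, part V: THE THREE DEAD-STAR KILLS WITH PARAMETRIC CORNER BUDGETS
(decomp-a2c lens-3 g39 node «ChargeFreeGap»; third input of the [G] port plan, after parts T and U)

The landed gapped fan machine kills the vertex stars `4T`, `3T+Q`, `3T+2H` of the abstract census data
(`bond`, `tri`, `ang`) by the lemmas `stub_kill4T`, `stub_kill3TQ`, `stub_kill3T2H`
(`GappedShellCensusShellTrichotomyStubKill{4T,3TQ,3T2H}`), whose corner bounds are the FIXED gapped constants
`arccos (1/4)` (T), `2·arccos (807/2000)` (Q), `arccos (807/2000)` (H).  For scale-free dozens at `1 %` the corner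
bounds are different (parts T, U: `T, H ≤ t₀ = arccos (31/100)`, `Q ≤ 2 t₀`, budget `5 t₀ < 2π`), so the three kills
are re-proved here ONCE AND FOR ALL with the corner maxima as PARAMETERS and the budget as a HYPOTHESIS:

* `kill4T_of_budget`   — T-corners `≤ tmax`, `4·tmax < 2π` ⇒ no `4T` star;
* `kill3TQ_of_budget`  — T-corners `≤ tmax`, quad corners `≤ qmax`, `3·tmax + qmax < 2π` ⇒ no `3T+Q` star;
* `kill3T2H_of_budget` — T-corners `≤ tmax`, half-quad corners `≤ hmax`, `3·tmax + 2·hmax < 2π` ⇒ no `3T+2H` star.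

The conclusions are literally the fields `noFourT`, `noThreeTQ`, `noThreeTHH` of `ShellCensusSearch.CF`; the hypotheses
on (`bond`, `tri`, `ang`) are those of the gapped stubs verbatim (proofs after them: localise the angle sum `2π` to the
star of `v`, bound the sum over the star literal by the sum of the corner values using only `ang ≥ 0`, add up).
At `1 %`: `tmax = hmax = arccos (31/100)`, `qmax = 2·arccos (31/100)`, budgets `4 t₀ < 5 t₀ < 2π` (part U
`five_arccos_lt_two_pi`).

No `sorry`, no new axiom, no instance / notation / option; no new definitions.
-/

noncomputable section

namespace Summit.AtomisticToContinuum.Crystallization.Theorems.ChargedEnergyGapChartDial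

open Real

/-! ## §1 Two bookkeeping lemmas (as in the gapped stubs) -/

/-- Summing a nonnegative function over `insert p s` gives at most `f p` plus the sum over `s` (no freshness). -/
theorem sum_insert_le_add_of_nonneg {ι : Type*} [DecidableEq ι] (f : ι → ℝ) (hf : ∀ i, 0 ≤ f i) (p : ι)
    (s : Finset ι) : ∑ i ∈ insert p s, f i ≤ f p + ∑ i ∈ s, f i := by
  by_cases hp : p ∈ s
  · rw [Finset.insert_eq_of_mem hp]
    linarith [hf p]
  · rw [Finset.sum_insert hp]

/-- A triple `{p, q, r}` with its three sides bonded is a bond clique. -/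
private theorem bondClique_of_triple (bond : Fin 12 → Fin 12 → Bool) (bond_symm : ∀ v w, bond v w = bond w v)
    (p q r : Fin 12) (hpq : bond p q = true) (hqr : bond q r = true) (hpr : bond p r = true) :
    ∀ y ∈ ({p, q, r} : Finset (Fin 12)), ∀ z ∈ ({p, q, r} : Finset (Fin 12)), y ≠ z → bond y z = true := by
  intro y hy z hz hne
  simp only [Finset.mem_insert, Finset.mem_singleton] at hy hz
  rcases hy with rfl | rfl | rfl <;> rcases hz with rfl | rfl | rfl <;>
    first
    | exact absurd rfl hne
    | assumption
    | (rw [bond_symm]; assumption)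

/-- The full angle `2π` at `v` is carried by the star of `v`. -/
theorem sum_star_eq_two_pi (tri : Finset (Finset (Fin 12))) (ang : Finset (Fin 12) → Fin 12 → ℝ)
    (ang_zero : ∀ S v, v ∉ S → ang S v = 0) (sum_ang : ∀ v, ∑ S ∈ tri, ang S v = 2 * Real.pi) (v : Fin 12) :
    ∑ S ∈ tri.filter (fun S => v ∈ S), ang S v = 2 * Real.pi := by
  rw [Finset.sum_filter_of_ne, sum_ang]
  intro S _ hne
  by_contra h
  exact hne (ang_zero S v h)

/-! ## §2 The three kills -/

/-- **Kill `4T` (parametric)**: four bond-triangle corners `≤ tmax` with `4·tmax < 2π` cannot fill the star. -/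
theorem kill4T_of_budget (bond : Fin 12 → Fin 12 → Bool) (tri : Finset (Finset (Fin 12)))
    (ang : Finset (Fin 12) → Fin 12 → ℝ) (bond_symm : ∀ v w, bond v w = bond w v)
    (ang_nonneg : ∀ S v, 0 ≤ ang S v) (ang_zero : ∀ S v, v ∉ S → ang S v = 0)
    (sum_ang : ∀ v, ∑ S ∈ tri, ang S v = 2 * Real.pi) {tmax : ℝ}
    (tCorner : ∀ S ∈ tri, (∀ v ∈ S, ∀ w ∈ S, v ≠ w → bond v w = true) → ∀ v ∈ S, ang S v ≤ tmax)
    (h4 : 4 * tmax < 2 * Real.pi) (v a b c d : Fin 12)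
    (hstar : (tri.filter fun S => v ∈ S) = {{v, a, b}, {v, b, c}, {v, c, d}, {v, d, a}})
    (hva : bond v a = true) (hvb : bond v b = true) (hvc : bond v c = true) (hvd : bond v d = true)
    (hab : bond a b = true) (hbc : bond b c = true) (hcd : bond c d = true) (hda : bond d a = true) :
    False := by
  have hsum := sum_star_eq_two_pi tri ang ang_zero sum_ang v
  rw [hstar] at hsum
  have memF : ∀ S ∈ ({{v, a, b}, {v, b, c}, {v, c, d}, {v, d, a}} : Finset (Finset (Fin 12))), S ∈ tri := by
    intro S hS
    rw [← hstar] at hS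
    exact (Finset.mem_filter.1 hS).1
  have m1 : ({v, a, b} : Finset (Fin 12)) ∈ tri := memF _ (by simp)
  have m2 : ({v, b, c} : Finset (Fin 12)) ∈ tri := memF _ (by simp)
  have m3 : ({v, c, d} : Finset (Fin 12)) ∈ tri := memF _ (by simp)
  have m4 : ({v, d, a} : Finset (Fin 12)) ∈ tri := memF _ (by simp)
  have h1 : ang {v, a, b} v ≤ tmax :=
    tCorner _ m1 (bondClique_of_triple bond bond_symm v a b hva hab hvb) v (Finset.mem_insert_self _ _)
  have h2 : ang {v, b, c} v ≤ tmax :=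
    tCorner _ m2 (bondClique_of_triple bond bond_symm v b c hvb hbc hvc) v (Finset.mem_insert_self _ _)
  have h3 : ang {v, c, d} v ≤ tmax :=
    tCorner _ m3 (bondClique_of_triple bond bond_symm v c d hvc hcd hvd) v (Finset.mem_insert_self _ _)
  have h4' : ang {v, d, a} v ≤ tmax :=
    tCorner _ m4 (bondClique_of_triple bond bond_symm v d a hvd hda hva) v (Finset.mem_insert_self _ _)
  have key : ∀ (p : Finset (Fin 12)) (s : Finset (Finset (Fin 12))),
      ∑ S ∈ insert p s, ang S v ≤ ang p v + ∑ S ∈ s, ang S v := fun p s =>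
    sum_insert_le_add_of_nonneg (fun S => ang S v) (fun S => ang_nonneg S v) p s
  have k1 := key {v, a, b} {{v, b, c}, {v, c, d}, {v, d, a}}
  have k2 := key {v, b, c} {{v, c, d}, {v, d, a}}
  have k3 := key {v, c, d} {{v, d, a}}
  have k4 : ∑ S ∈ ({{v, d, a}} : Finset (Finset (Fin 12))), ang S v = ang {v, d, a} v := by
    rw [Finset.sum_singleton]
  linarith

/-- **Kill `3T+Q` (parametric)**: three bond-triangle corners `≤ tmax` and one quad corner `≤ qmax` with
`3·tmax + qmax < 2π` cannot fill the star. -/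
theorem kill3TQ_of_budget (bond : Fin 12 → Fin 12 → Bool) (tri : Finset (Finset (Fin 12)))
    (ang : Finset (Fin 12) → Fin 12 → ℝ) (bond_symm : ∀ v w, bond v w = bond w v)
    (ang_nonneg : ∀ S v, 0 ≤ ang S v) (ang_zero : ∀ S v, v ∉ S → ang S v = 0)
    (sum_ang : ∀ v, ∑ S ∈ tri, ang S v = 2 * Real.pi) {tmax qmax : ℝ}
    (tCorner : ∀ S ∈ tri, (∀ v ∈ S, ∀ w ∈ S, v ≠ w → bond v w = true) → ∀ v ∈ S, ang S v ≤ tmax)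
    (qCorner : ∀ v d a x, ({v, d, a} : Finset (Fin 12)) ∈ tri → bond v d = true → bond v a = true →
      bond d a = false → d ≠ a → bond d x = true → bond x a = true → bond v x = false → x ≠ v →
      ang {v, d, a} v ≤ qmax)
    (hb : 3 * tmax + qmax < 2 * Real.pi) (v a b c d x : Fin 12)
    (hstar : (tri.filter fun S => v ∈ S) = {{v, a, b}, {v, b, c}, {v, c, d}, {v, d, a}})
    (hva : bond v a = true) (hvb : bond v b = true) (hvc : bond v c = true) (hvd : bond v d = true)
    (hab : bond a b = true) (hbc : bond b c = true) (hcd : bond c d = true) (hda : bond d a = false)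
    (hda' : d ≠ a) (hdx : bond d x = true) (hxa : bond x a = true) (hvx : bond v x = false) (hxv : x ≠ v) :
    False := by
  have hsum := sum_star_eq_two_pi tri ang ang_zero sum_ang v
  rw [hstar] at hsum
  have memF : ∀ S ∈ ({{v, a, b}, {v, b, c}, {v, c, d}, {v, d, a}} : Finset (Finset (Fin 12))), S ∈ tri := by
    intro S hS
    rw [← hstar] at hS
    exact (Finset.mem_filter.1 hS).1
  have m1 : ({v, a, b} : Finset (Fin 12)) ∈ tri := memF _ (by simp)
  have m2 : ({v, b, c} : Finset (Fin 12)) ∈ tri := memF _ (by simp)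
  have m3 : ({v, c, d} : Finset (Fin 12)) ∈ tri := memF _ (by simp)
  have m4 : ({v, d, a} : Finset (Fin 12)) ∈ tri := memF _ (by simp)
  have h1 : ang {v, a, b} v ≤ tmax :=
    tCorner _ m1 (bondClique_of_triple bond bond_symm v a b hva hab hvb) v (Finset.mem_insert_self _ _)
  have h2 : ang {v, b, c} v ≤ tmax :=
    tCorner _ m2 (bondClique_of_triple bond bond_symm v b c hvb hbc hvc) v (Finset.mem_insert_self _ _)
  have h3 : ang {v, c, d} v ≤ tmax :=
    tCorner _ m3 (bondClique_of_triple bond bond_symm v c d hvc hcd hvd) v (Finset.mem_insert_self _ _)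
  have h4 : ang {v, d, a} v ≤ qmax := qCorner v d a x m4 hvd hva hda hda' hdx hxa hvx hxv
  have key : ∀ (p : Finset (Fin 12)) (s : Finset (Finset (Fin 12))),
      ∑ S ∈ insert p s, ang S v ≤ ang p v + ∑ S ∈ s, ang S v := fun p s =>
    sum_insert_le_add_of_nonneg (fun S => ang S v) (fun S => ang_nonneg S v) p s
  have k1 := key {v, a, b} {{v, b, c}, {v, c, d}, {v, d, a}}
  have k2 := key {v, b, c} {{v, c, d}, {v, d, a}}
  have k3 := key {v, c, d} {{v, d, a}}
  have k4 : ∑ S ∈ ({{v, d, a}} : Finset (Finset (Fin 12))), ang S v = ang {v, d, a} v := by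
    rw [Finset.sum_singleton]
  linarith

/-- **Kill `3T+2H` (parametric)**: three bond-triangle corners `≤ tmax` and the two half-quad corners `≤ hmax` with
`3·tmax + 2·hmax < 2π` cannot fill the star. -/
theorem kill3T2H_of_budget (bond : Fin 12 → Fin 12 → Bool) (tri : Finset (Finset (Fin 12)))
    (ang : Finset (Fin 12) → Fin 12 → ℝ) (bond_symm : ∀ v w, bond v w = bond w v)
    (ang_nonneg : ∀ S v, 0 ≤ ang S v) (ang_zero : ∀ S v, v ∉ S → ang S v = 0)
    (sum_ang : ∀ v, ∑ S ∈ tri, ang S v = 2 * Real.pi) {tmax hmax : ℝ}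
    (tCorner : ∀ S ∈ tri, (∀ v ∈ S, ∀ w ∈ S, v ≠ w → bond v w = true) → ∀ v ∈ S, ang S v ≤ tmax)
    (hCorner : ∀ v a x, ({v, a, x} : Finset (Fin 12)) ∈ tri → bond v a = true → bond a x = true →
      bond v x = false → v ≠ x → ang {v, a, x} v ≤ hmax)
    (hb : 3 * tmax + 2 * hmax < 2 * Real.pi) (v a b c d x : Fin 12)
    (hstar : (tri.filter fun S => v ∈ S) = {{v, a, b}, {v, b, c}, {v, c, d}, {v, d, x}, {v, a, x}})
    (hva : bond v a = true) (hvb : bond v b = true) (hvc : bond v c = true) (hvd : bond v d = true)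
    (hab : bond a b = true) (hbc : bond b c = true) (hcd : bond c d = true) (hdx : bond d x = true)
    (hax : bond a x = true) (hvx : bond v x = false) (hvx' : v ≠ x) :
    False := by
  have hsum := sum_star_eq_two_pi tri ang ang_zero sum_ang v
  rw [hstar] at hsum
  have memF : ∀ S ∈ ({{v, a, b}, {v, b, c}, {v, c, d}, {v, d, x}, {v, a, x}} : Finset (Finset (Fin 12))),
      S ∈ tri := by
    intro S hS
    rw [← hstar] at hS
    exact (Finset.mem_filter.1 hS).1
  have m1 : ({v, a, b} : Finset (Fin 12)) ∈ tri := memF _ (by simp)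
  have m2 : ({v, b, c} : Finset (Fin 12)) ∈ tri := memF _ (by simp)
  have m3 : ({v, c, d} : Finset (Fin 12)) ∈ tri := memF _ (by simp)
  have m4 : ({v, d, x} : Finset (Fin 12)) ∈ tri := memF _ (by simp)
  have m5 : ({v, a, x} : Finset (Fin 12)) ∈ tri := memF _ (by simp)
  have h1 : ang {v, a, b} v ≤ tmax :=
    tCorner _ m1 (bondClique_of_triple bond bond_symm v a b hva hab hvb) v (Finset.mem_insert_self _ _)
  have h2 : ang {v, b, c} v ≤ tmax :=
    tCorner _ m2 (bondClique_of_triple bond bond_symm v b c hvb hbc hvc) v (Finset.mem_insert_self _ _)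
  have h3 : ang {v, c, d} v ≤ tmax :=
    tCorner _ m3 (bondClique_of_triple bond bond_symm v c d hvc hcd hvd) v (Finset.mem_insert_self _ _)
  have h4 : ang {v, d, x} v ≤ hmax := hCorner v d x m4 hvd hdx hvx hvx'
  have h5 : ang {v, a, x} v ≤ hmax := hCorner v a x m5 hva hax hvx hvx'
  have key : ∀ (p : Finset (Fin 12)) (s : Finset (Finset (Fin 12))),
      ∑ S ∈ insert p s, ang S v ≤ ang p v + ∑ S ∈ s, ang S v := fun p s =>
    sum_insert_le_add_of_nonneg (fun S => ang S v) (fun S => ang_nonneg S v) p s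
  have k1 := key {v, a, b} {{v, b, c}, {v, c, d}, {v, d, x}, {v, a, x}}
  have k2 := key {v, b, c} {{v, c, d}, {v, d, x}, {v, a, x}}
  have k3 := key {v, c, d} {{v, d, x}, {v, a, x}}
  have k4 := key {v, d, x} {{v, a, x}}
  have k5 : ∑ S ∈ ({{v, a, x}} : Finset (Finset (Fin 12))), ang S v = ang {v, a, x} v := by
    rw [Finset.sum_singleton]
  linarith

/-! ## §3 The `1 %` instances of the budgets (parts T, U supply `t₀ = arccos (31/100)` and `5 t₀ < 2π`) -/

/-- With a single corner constant `t₀` for T- and half-quad corners and `2 t₀` for quad corners, the three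
budgets follow from `5 t₀ < 2π` (and `0 ≤ t₀`). -/
theorem budgets_of_five_lt {t₀ : ℝ} (h0 : 0 ≤ t₀) (h5 : 5 * t₀ < 2 * Real.pi) :
    4 * t₀ < 2 * Real.pi ∧ 3 * t₀ + 2 * t₀ < 2 * Real.pi :=
  ⟨by linarith, by linarith⟩

end Summit.AtomisticToContinuum.Crystallization.Theorems.ChargedEnergyGapChartDial

end
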